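import Summits.ABC.ABC.Theses.CongruentialReceptacle
import Summits.ABC.ABC.Theorems.CongruentialReceptacleBalancedFreySzpiroStubFreyModelSqLe
import Literature.NumberTheory.EllipticCurves.SzpiroSixFifthsProofs
import Literature.NumberTheory.EllipticCurves.SzpiroOfAbcProofs
import Literature.NumberTheory.DiophantineGeometry.MinimalDiscriminantNormProofs
import HarnessLib

/-!
# Crux `BalancedFreySzpiro` (stmt-ABC-1723) — line `SketchIdeator1` (card `szpiro-trace-port`), skeleton

The crux: for every `κ > 0`, `ε > 0` there is `C` with `(abc)² ≤ C · rad(abc)^(6+ε)` for all abc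
triples with `κc ≤ a`, `κc ≤ b` (Szpiro `6+ε` for the Frey curves of compactly balanced triples, in
elementary currency).

Line (port of a Szpiro engine through the global minimal Frey model; the balance hypotheses are inert):

* `stub_freyModelSqLe` — every abc triple carries a global minimal integral Frey model `W₀` (B–G
  12.5.10, (12.17)/(12.18)) with conductor `∣ 2¹⁰ · rad(abc)` and `(abc)² ≤ 2⁸ · |Δ(W₀)|`
  (M-sized; provable from the tree's `exists_arrangement`, `freyIntModel(₂)` API);
* `stub_szpiroMinimalModel` — THE HARD STUB: Szpiro's `|Δ(W₀)| ≤ C(ε) · N^(6+ε)` for minimal integral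
  models (`= SzpiroConjecture` read on integral models via `minimalDiscriminantNorm_eq_natAbs_holds`;
  abc-strength — the item's own why-might-fail);
* `BalancedFreySzpiro_of` — the composition (proved): `(abc)² ≤ 2⁸|Δ(W₀)| ≤ 2⁸ C N^(6+ε) ≤
  2⁸ C 2^(10(6+ε)) rad^(6+ε)`; balance unused.
-/

set_option linter.dupNamespace false

noncomputable section

open UniqueFactorizationMonoid IsDedekindDomain Real WeierstrassCurve Rat.HeightOneSpectrum
open Literature.NumberTheory.EllipticCurves Literature.NumberTheory.DiophantineGeometry
open Summit.ABC.ABC.Theses.CongruentialReceptacle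

namespace Summit.ABC.ABC.Theorems

-- Stub 1 `stub_freyModelSqLe` LANDED (worker, p96265, 2026-08-16): imported from
-- `Summits.ABC.ABC.Theorems.CongruentialReceptacleBalancedFreySzpiroStubFreyModelSqLe` (same FQN
-- `Summit.ABC.ABC.Theorems.stub_freyModelSqLe`, registered signature).

/-- **Stub 2 (`stub_szpiroMinimalModel`, the hard stub).** Szpiro's inequality for global minimal
integral models: for every `ε > 0` there is `C` such that every `W₀/ℤ`, elliptic over `ℚ` and minimal
at every prime, satisfies `|Δ(W₀)| ≤ C · N^(6+ε)` (`N` = conductor). This is `SzpiroConjecture`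
(Silverman AEC VIII.11.1) read on integral minimal models (`|Δ_min| = |Δ(W₀)|`,
`minimalDiscriminantNorm_eq_natAbs_holds`); open — abc-strength. -/
theorem stub_szpiroMinimalModel : ∀ ε : ℝ, 0 < ε → ∃ C : ℝ, ∀ W₀ : WeierstrassCurve ℤ,
    (W₀.baseChange ℚ).IsElliptic → (∀ v : HeightOneSpectrum ℤ, (W₀.baseChange ℚ).IsMinimalAt v) →
      (|W₀.Δ| : ℝ) ≤ C * (((W₀.baseChange ℚ).conductorNorm ℤ : ℕ) : ℝ) ^ (6 + ε) := by
  sorry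

/-- **Composition (glue, proved).** The two stub statements give the crux's body: read stub 2 on
the model of stub 1 and use `N ≤ 2¹⁰ rad(abc)`; the balance hypotheses `κc ≤ a`, `κc ≤ b` are not
used. [folklore; Oesterlé 1988 §3: Szpiro ⟹ `abc ≤ C · rad^(3+ε)`] -/
theorem szpiroPort_of_model_of_szpiro
    (h₁ : ∀ a b c : ℕ, IsABCTriple a b c →
      ∃ W₀ : WeierstrassCurve ℤ, (W₀.baseChange ℚ).IsElliptic ∧
        (∀ v : HeightOneSpectrum ℤ, (W₀.baseChange ℚ).IsMinimalAt v) ∧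
        (W₀.baseChange ℚ).conductorNorm ℤ ∣ 2 ^ 10 * rad a b c ∧
        ((a * b * c : ℕ) : ℤ) ^ 2 ≤ 2 ^ 8 * |W₀.Δ|)
    (h₂ : ∀ ε : ℝ, 0 < ε → ∃ C : ℝ, ∀ W₀ : WeierstrassCurve ℤ,
      (W₀.baseChange ℚ).IsElliptic → (∀ v : HeightOneSpectrum ℤ, (W₀.baseChange ℚ).IsMinimalAt v) →
        (|W₀.Δ| : ℝ) ≤ C * (((W₀.baseChange ℚ).conductorNorm ℤ : ℕ) : ℝ) ^ (6 + ε)) :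
    ∀ κ : ℝ, 0 < κ → ∀ ε : ℝ, 0 < ε → ∃ C : ℝ, ∀ a b c : ℕ, IsABCTriple a b c →
      κ * (c : ℝ) ≤ (a : ℝ) → κ * (c : ℝ) ≤ (b : ℝ) →
        ((a * b * c : ℕ) : ℝ) ^ 2 ≤ C * ((rad a b c : ℕ) : ℝ) ^ (6 + ε) := by
  intro κ _ ε hε
  obtain ⟨C₁, hC₁⟩ := h₂ ε hε
  set C : ℝ := max C₁ 1 with hCdef
  have hC0 : 0 ≤ C := zero_le_one.trans (le_max_right _ _)
  refine ⟨2 ^ 8 * C * ((2 : ℝ) ^ 10) ^ (6 + ε), fun a b c h _ _ ↦ ?_⟩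
  obtain ⟨W₀, hE, hmin, hN, hsq⟩ := h₁ a b c h
  have key := hC₁ W₀ hE hmin
  set N : ℝ := (((W₀.baseChange ℚ).conductorNorm ℤ : ℕ) : ℝ) with hNdef
  set R : ℝ := ((rad a b c : ℕ) : ℝ) with hRdef
  have hN0 : 0 ≤ N := by positivity
  have hR0 : 0 ≤ R := by positivity
  have h1 : (|W₀.Δ| : ℝ) ≤ C * N ^ (6 + ε) :=
    key.trans (mul_le_mul_of_nonneg_right (le_max_left _ _) (by positivity))
  have h2 : N ≤ 2 ^ 10 * R := by
    have := Nat.le_of_dvd (mul_pos (by positivity) (by rw [rad_def]; exact Nat.radical_pos _)) hN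
    rw [hNdef, hRdef]; exact_mod_cast this
  have hsq' : ((a * b * c : ℕ) : ℝ) ^ 2 ≤ 2 ^ 8 * (|W₀.Δ| : ℝ) := by
    have : (((a * b * c : ℕ) : ℤ) : ℝ) ^ 2 ≤ ((2 ^ 8 * |W₀.Δ| : ℤ) : ℝ) := by exact_mod_cast hsq
    push_cast at this ⊢
    linarith
  calc ((a * b * c : ℕ) : ℝ) ^ 2 ≤ 2 ^ 8 * (|W₀.Δ| : ℝ) := hsq'
    _ ≤ 2 ^ 8 * (C * N ^ (6 + ε)) := by linarith
    _ ≤ 2 ^ 8 * (C * (2 ^ 10 * R) ^ (6 + ε)) := by gcongr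
    _ = (2 ^ 8 * C * ((2 : ℝ) ^ 10) ^ (6 + ε)) * R ^ (6 + ε) := by
        rw [Real.mul_rpow (by positivity) hR0]; ring

/-- **The crux from the registered stubs (`BalancedFreySzpiro_of`).** Becomes the closing theorem of
item stmt-ABC-1723 once `stub_freyModelSqLe` and `stub_szpiroMinimalModel` are discharged. -/
theorem BalancedFreySzpiro_of : BalancedFreySzpiro := by
  unfold BalancedFreySzpiro
  exact szpiroPort_of_model_of_szpiro stub_freyModelSqLe stub_szpiroMinimalModel

end Summit.ABC.ABC.Theorems

end
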